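import Mathlib
import HarnessLib.Audit
import Summits.PneNP.PneNP.Theorems.PstarCrossCoupled

/-!
# The blind free COTREE-partner gate is the implication-coupled datum: `CoupledFour → TerminalFiveCotree1Blind` (ROUND-25, memo §14.34; p3's prover item of `PstarCoupled`)

FRONTIER range-avoidance ladder, rung F-N3, ROUND 25 (cell `pnp-ideate`, planner memo `r24/CORE-BOUND-NOTES.md` §14.34; restricted-model proof complexity — nothing here bears
on `P` versus `NP`).

Setting of `PstarCoupled.TerminalFiveCotree1Blind`: a terminal pair `(w₁, w₂)` on `J₀`, one gate `g₀ = x_v · x_u` of `w₁` with `v` a private of the chord `e` (mate `v'`) and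
`u` an AND-input of a cotree edge, every other monomial hun-clean, `w₂` not reading `v, v'`, both `v, u` free on `Z = Sol_y(J₀) ∩ {w₂ = t₂}`.  The fibre lemma
`PstarCrossBlind.or_shape_at` (which only needs `u ∉ {v, v'}`) gives at every point of `Z` with `x_v = 0`: `v' ∉ w₁.1` and `x_u = λ_v := [v ∈ w₁.1]`.  Hence
`w₁ = R + x_v · ℓ` with `ℓ := x_u + λ_v`, and with the CLEAN member `A := R + x_u` (target `¬t₁ + λ_v`) the Terminal datum on `J₀` becomes the datum `CoupledFour` of
`PstarCoupled` on `J₀ ∖ e` (implication `A = a`, monotone coupling `ℓ ⟹ s_e`, polarity `pol := λ_v`):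

* `bit_gval_gate` — `w₁(x) = A(x) + x_u + x_v · (λ_v + x_u)`;
* `cotree1Blind_core` — the reduction for an explicit orientation `(v, u)` of the gate; `cotree1Blind_of_coupledFour : CoupledFour → TerminalFiveCotree1Blind`.
-/

set_option linter.dupNamespace false -- `Summit.PneNP.PneNP.…`: summit = sub-problem name (D-0017 single-conjunct layout)

open Finset Literature.Computability.Complexity
open scoped symmDiff
open Summit.PneNP.PneNP.Theorems.PstarFibrePolys (bit bit_injective bit_xor)
open Summit.PneNP.PneNP.Theorems.PstarTyped (Typed)
open Summit.PneNP.PneNP.Theorems.PstarSALevel (varSet bdry BoundaryExpanding SimpleOverlap)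
open Summit.PneNP.PneNP.Theorems.PstarGapPeeling (not_mem_varSet_of_private eval_pure)
open Summit.PneNP.PneNP.Theorems.PstarCentreFree (vars_mem_varSet)
open Summit.PneNP.PneNP.Theorems.PstarGapOneAll (gval)
open Summit.PneNP.PneNP.Theorems.PstarGConstraint (bit_gval gval_update_of_forall_ne)
open Summit.PneNP.PneNP.Theorems.PstarCoreBound (XorClosed)
open Summit.PneNP.PneNP.Theorems.PstarChordRepair (IsChord)
open Summit.PneNP.PneNP.Theorems.PstarChordBridgeCotree (Peelable)
open Summit.PneNP.PneNP.Theorems.PstarChordBridgeTools (privs mem_privs)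
open Summit.PneNP.PneNP.Theorems.PstarCoreBoundTargets (Terminal)
open Summit.PneNP.PneNP.Theorems.PstarUnion (SatPair)
open Summit.PneNP.PneNP.Theorems.PstarUnionCaseB (setPair_two setPair_of_ne eval_setPair_of_ne)
open Summit.PneNP.PneNP.Theorems.PstarChordReadShared (gval_singleton gval_symmDiff_singleton)
open Summit.PneNP.PneNP.Theorems.PstarChordReadCoupledSplit (gval_erase_mono)
open Summit.PneNP.PneNP.Theorems.PstarCrossBlind (or_shape_at sol_update_pair)
open Summit.PneNP.PneNP.Theorems.PstarCoupled (CotreeGate sform CoupledFour TerminalFiveCotree1Blind)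
open Summit.PneNP.PneNP.Theorems.PstarCrossCoupled (eval_iff_sform sform_setPair)

namespace Summit.PneNP.PneNP.Theorems.PstarCotreeCoupled

variable {n m : ℕ}

/-- **`w₁(x) = A(x) + x_u + x_v (λ_v + x_u)`** for `A := ((w₁.1.erase v) ∆ {u}, w₁.2.1.erase g₀)`, `g₀` the gate on `{v, u}`, `λ_v := [v ∈ w₁.1]`. -/
theorem bit_gval_gate (I : LocalMap 4 n m) (w₁ : Finset (Fin n) × Finset (Fin m) × Bool) {g₀ : Fin m} (hg₀ : g₀ ∈ w₁.2.1) {v u : Fin n}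
    (hgv : (I.vars g₀ 2 = v ∧ I.vars g₀ 3 = u) ∨ (I.vars g₀ 2 = u ∧ I.vars g₀ 3 = v)) (x : Fin n → Bool) :
    bit (gval I w₁.1 w₁.2.1 x) = bit (gval I ((w₁.1.erase v) ∆ {u}) (w₁.2.1.erase g₀) x) + bit (x u) +
      bit (x v) * ((if v ∈ w₁.1 then 1 else 0) + bit (x u)) := by
  classical
  have hgate : (x (I.vars g₀ 2) && x (I.vars g₀ 3)) = (x v && x u) := by
    rcases hgv with ⟨h2, h3⟩ | ⟨h2, h3⟩
    · rw [h2, h3]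
    · rw [h2, h3, Bool.and_comm]
  rw [gval_erase_mono I w₁.1 w₁.2.1 g₀ x, decide_eq_true hg₀, Bool.true_and, hgate, bit_xor, gval_symmDiff_singleton, bit_xor, bit_gval,
    bit_gval]
  have e : ∀ a b : Bool, bit (a && b) = bit a * bit b := by decide
  have h2 : bit (x u) + bit (x u) = 0 := by generalize bit (x u) = a; revert a; decide
  rw [e]
  by_cases hv : v ∈ w₁.1
  · rw [if_pos hv, ← sum_erase_add _ _ hv]
    linear_combination (-1 : ZMod 2) * h2
  · rw [if_neg hv, erase_eq_of_notMem hv]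
    linear_combination (-1 : ZMod 2) * h2

/-- **The E2 reduction for an oriented gate `g₀ = x_v · x_u`** (`v` a chord private, `u` a cotree AND-input, both free on `Z`, `w₂` blind to `v`'s chord). -/
theorem cotree1Blind_core (hC : CoupledFour) {r : ℕ} (I : LocalMap 4 n m) (hI : I.IsPure xorAndPred) (hT : Typed I) (hS : SimpleOverlap I)
    (hB : BoundaryExpanding r I) {y : Fin m → Bool} {J₀ : Finset (Fin m)} {w₁ w₂ : Finset (Fin n) × Finset (Fin m) × Bool}
    (ht : Terminal I r y J₀ w₁ w₂) {F : Finset (Fin m)} (hF : F ⊆ J₀) (hP : Peelable I F)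
    (hmax : ∀ F', F ⊆ F' → F' ⊆ J₀ → Peelable I F' → F' = F) (hch : ∀ e ∈ J₀ \ F, IsChord I J₀ e)
    {g₀ : Fin m} (hg₀ : g₀ ∈ w₁.2.1) {v u : Fin n} (hgv : (I.vars g₀ 2 = v ∧ I.vars g₀ 3 = u) ∨ (I.vars g₀ 2 = u ∧ I.vars g₀ 3 = v))
    (hvpriv : v ∈ privs I (J₀ \ F)) (hu : ∃ j₀ ∈ F, u = I.vars j₀ 2 ∨ u = I.vars j₀ 3)
    (hun : ∀ g ∈ (w₁.2.1.erase g₀) ∪ w₂.2.1, ∀ w ∈ privs I (J₀ \ F), I.vars g 2 ≠ w ∧ I.vars g 3 ≠ w)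
    (hfv : ∀ c : Bool, SatPair I y J₀ (({v} : Finset (Fin n)), (∅ : Finset (Fin m)), c) w₂)
    (hfu : ∀ c : Bool, SatPair I y J₀ (({u} : Finset (Fin n)), (∅ : Finset (Fin m)), c) w₂)
    (hbl : ∀ e ∈ J₀ \ F, (I.vars e 2 = v ∨ I.vars e 3 = v) → I.vars e 2 ∉ w₂.1 ∧ I.vars e 3 ∉ w₂.1) : J₀.card ≤ 5 := by
  classical
  obtain ⟨-, hX, hJr, hd₁, hd₂, hrad, hT3, hM0⟩ := id ht
  have hT3' : ∀ z : Fin n → Bool, (∀ j ∈ J₀, I.eval z j = y j) → gval I w₂.1 w₂.2.1 z = w₂.2.2 → gval I w₁.1 w₁.2.1 z ≠ w₁.2.2 :=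
    fun z hz hzw h1 => hT3 ⟨z, hz, h1, hzw⟩
  have hg₀J : g₀ ∉ J₀ := fun h => Finset.disjoint_left.1 hd₁ h hg₀
  have huv : u ≠ v := by
    have h := hI.2 g₀
    rcases hgv with ⟨h2, h3⟩ | ⟨h2, h3⟩
    · rw [← h2, ← h3]; exact fun e => absurd (h e) (by decide)
    · rw [← h2, ← h3]; exact fun e => absurd (h e.symm) (by decide)
  -- the chord of `v` and its mate
  obtain ⟨e, he, hev0⟩ := (mem_privs I).1 hvpriv
  have heJ : e ∈ J₀ := (mem_sdiff.1 he).1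
  obtain ⟨v', hev⟩ : ∃ v', (I.vars e 2 = v ∧ I.vars e 3 = v') ∨ (I.vars e 2 = v' ∧ I.vars e 3 = v) := by
    rcases hev0 with h | h
    · exact ⟨I.vars e 3, Or.inl ⟨h, rfl⟩⟩
    · exact ⟨I.vars e 2, Or.inr ⟨rfl, h⟩⟩
  have hv'0 : I.vars e 2 = v' ∨ I.vars e 3 = v' := by
    rcases hev with ⟨-, h⟩ | ⟨h, -⟩
    · exact Or.inr h
    · exact Or.inl h
  have hv'priv : v' ∈ privs I (J₀ \ F) := (mem_privs I).2 ⟨e, he, hv'0⟩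
  have hvs : ∀ {w : Fin n}, (I.vars e 2 = w ∨ I.vars e 3 = w) → w ∈ varSet I e := by
    rintro w (h | h) <;> rw [← h] <;> exact vars_mem_varSet I e _
  -- `u` is inside `F`: not a private of `e`
  obtain ⟨j₀, hj₀, hju⟩ := hu
  have hj₀J : j₀ ∈ J₀ := hF hj₀
  have hje : j₀ ≠ e := fun h => (mem_sdiff.1 he).2 (h ▸ hj₀)
  have hu_vs : u ∈ varSet I j₀ := by
    rcases hju with h | h <;> rw [h] <;> exact vars_mem_varSet I j₀ _
  have notpriv : ∀ {w : Fin n}, (I.vars e 2 = w ∨ I.vars e 3 = w) → w ≠ u := by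
    intro w hw hwu
    subst hwu
    rcases hw with h | h
    · exact not_mem_varSet_of_private I heJ hj₀J hje (hch e he).1 (vars_mem_varSet I e 2) (h ▸ hu_vs)
    · exact not_mem_varSet_of_private I heJ hj₀J hje (hch e he).2 (vars_mem_varSet I e 3) (h ▸ hu_vs)
  have huv' : u ≠ v' := (notpriv hv'0).symm
  -- cleanliness on `v, v'`
  have hm₁ : ∀ g ∈ w₁.2.1.erase g₀, I.vars g 2 ≠ v ∧ I.vars g 3 ≠ v ∧ I.vars g 2 ≠ v' ∧ I.vars g 3 ≠ v' := fun g hg =>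
    ⟨(hun g (mem_union_left _ hg) v hvpriv).1, (hun g (mem_union_left _ hg) v hvpriv).2,
      (hun g (mem_union_left _ hg) v' hv'priv).1, (hun g (mem_union_left _ hg) v' hv'priv).2⟩
  have hbl' := hbl e he hev0
  have hw₂v : v ∉ w₂.1 ∧ v' ∉ w₂.1 ∧ ∀ g ∈ w₂.2.1, I.vars g 2 ≠ v ∧ I.vars g 3 ≠ v ∧ I.vars g 2 ≠ v' ∧ I.vars g 3 ≠ v' := by
    refine ⟨?_, ?_, fun g hg => ⟨(hun g (mem_union_right _ hg) v hvpriv).1, (hun g (mem_union_right _ hg) v hvpriv).2,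
      (hun g (mem_union_right _ hg) v' hv'priv).1, (hun g (mem_union_right _ hg) v' hv'priv).2⟩⟩
    · rcases hev0 with h | h
      · rw [← h]; exact hbl'.1
      · rw [← h]; exact hbl'.2
    · rcases hv'0 with h | h
      · rw [← h]; exact hbl'.1
      · rw [← h]; exact hbl'.2
  have hg₀2 : g₀ ∉ w₂.2.1 := by
    intro h
    rcases hgv with ⟨h2, -⟩ | ⟨-, h3⟩
    · exact (hun g₀ (mem_union_right _ h) v hvpriv).1 h2
    · exact (hun g₀ (mem_union_right _ h) v hvpriv).2 h3
  -- the fibre lemma at the free point: `v'` unread, and `λ_v` is the value of `x_u` on the `x_v = 0` part of `Z`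
  have shape : ∀ z : Fin n → Bool, (∀ j ∈ J₀, I.eval z j = y j) → gval I w₂.1 w₂.2.1 z = w₂.2.2 → z v = false →
      v' ∉ w₁.1 ∧ (v ∈ w₁.1 ↔ z u = true) := fun z hz hzw hzv =>
    or_shape_at I hI hT3' heJ (hch e he) hev hg₀ hgv huv huv' hm₁ hw₂v hz hzw hzv
  obtain ⟨z₀, hz₀J, hz₀0, hz₀w⟩ := hfv false
  have hz₀v : z₀ v = false := by
    have h : gval I {v} ∅ z₀ = false := hz₀0
    rwa [gval_singleton] at h
  have hv'C : v' ∉ w₁.1 := (shape z₀ hz₀J hz₀w hz₀v).1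
  -- the clean member `A`
  set pol : Bool := decide (v ∈ w₁.1) with hpol
  have hlam : (if v ∈ w₁.1 then (1 : ZMod 2) else 0) = bit pol := by
    rw [hpol]; by_cases h : v ∈ w₁.1 <;> simp [h, bit]
  have hAv : v ∉ (w₁.1.erase v) ∆ ({u} : Finset (Fin n)) := by
    rw [mem_symmDiff, mem_erase, mem_singleton]; push Not
    exact ⟨fun h => absurd rfl h.1, fun h => absurd h huv.symm⟩
  have hAv' : v' ∉ (w₁.1.erase v) ∆ ({u} : Finset (Fin n)) := by
    rw [mem_symmDiff, mem_erase, mem_singleton]; push Not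
    exact ⟨fun h => absurd h.2 hv'C, fun h => absurd h huv'.symm⟩
  have invA : ∀ (x : Fin n → Bool) (a b : Bool),
      gval I ((w₁.1.erase v) ∆ {u}) (w₁.2.1.erase g₀) (Function.update (Function.update x v a) v' b) =
        gval I ((w₁.1.erase v) ∆ {u}) (w₁.2.1.erase g₀) x ∧
      gval I w₂.1 w₂.2.1 (Function.update (Function.update x v a) v' b) = gval I w₂.1 w₂.2.1 x := by
    intro x a b
    constructor
    · rw [gval_update_of_forall_ne I _ hAv' (fun g hg => ⟨(hm₁ g hg).2.2.1, (hm₁ g hg).2.2.2⟩),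
        gval_update_of_forall_ne I _ hAv (fun g hg => ⟨(hm₁ g hg).1, (hm₁ g hg).2.1⟩)]
    · rw [gval_update_of_forall_ne I _ hw₂v.2.1 (fun g hg => ⟨(hw₂v.2.2 g hg).2.2.1, (hw₂v.2.2 g hg).2.2.2⟩),
        gval_update_of_forall_ne I _ hw₂v.1 (fun g hg => ⟨(hw₂v.2.2 g hg).1, (hw₂v.2.2 g hg).2.1⟩)]
  -- `e` holds iff the pair product is the XOR side; the XOR side ignores the pair
  have hvv' : v ≠ v' := by
    have h23 : I.vars e 2 ≠ I.vars e 3 := fun h => absurd (hI.2 e h) (by decide)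
    rcases hev with ⟨h2, h3⟩ | ⟨h2, h3⟩
    · rw [← h2, ← h3]; exact h23
    · rw [← h2, ← h3]; exact h23.symm
  have prod_e : ∀ z : Fin n → Bool, (z (I.vars e 2) && z (I.vars e 3)) = (z v && z v') := by
    intro z
    rcases hev with ⟨h2, h3⟩ | ⟨h2, h3⟩
    · rw [h2, h3]
    · rw [h2, h3, Bool.and_comm]
  have sform_upd : ∀ (x : Fin n → Bool) (a b : Bool), sform I y e (Function.update (Function.update x v a) v' b) = sform I y e x := by
    intro x a b
    rcases hev with ⟨h2, h3⟩ | ⟨h2, h3⟩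
    · rw [← h2, ← h3]; exact sform_setPair I hI y e x a b
    · rw [← h2, ← h3, Function.update_comm (fun h => absurd (hI.2 e h) (by decide))]; exact sform_setPair I hI y e x b a
  have chord_s : ∀ {z : Fin n → Bool}, (∀ j ∈ J₀, I.eval z j = y j) → z v = false → sform I y e z = false := by
    intro z hz hzv
    have h := (eval_iff_sform I hI y e z).1 (hz e heJ)
    rw [prod_e, hzv, Bool.false_and] at h
    exact h.symm
  -- apply `CoupledFour`
  refine hC n m r I hI hT hS hB y J₀ F e (((w₁.1.erase v) ∆ {u}), w₁.2.1.erase g₀, xor (!w₁.2.2) pol) w₂ u pol hX hJr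
    (hd₁.mono_right (erase_subset _ _)) hd₂ ?_ hF hP hmax hch he ⟨j₀, hj₀, hju⟩ ?_ ?_ ?_ ?_ ?_ ?_ ?_ ?_ ?_
  · -- radius slack
    have hsub : J₀ ∪ w₁.2.1.erase g₀ ∪ w₂.2.1 ⊆ (J₀ ∪ w₁.2.1 ∪ w₂.2.1).erase g₀ := by
      intro j hj
      rw [mem_erase]
      rcases mem_union.1 hj with hj | hj
      · rcases mem_union.1 hj with hj | hj
        · exact ⟨fun h => hg₀J (h ▸ hj), mem_union_left _ (mem_union_left _ hj)⟩
        · exact ⟨(mem_erase.1 hj).1, mem_union_left _ (mem_union_right _ (mem_erase.1 hj).2)⟩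
      · exact ⟨fun h => hg₀2 (h ▸ hj), mem_union_right _ hj⟩
    exact lt_of_le_of_lt (card_le_card hsub) (lt_of_lt_of_le (card_erase_lt_of_mem (mem_union_left _ (mem_union_right _ hg₀))) hrad)
  · intro g hg w hw; exact hun g hg w hw
  · rcases hev with ⟨h2, -⟩ | ⟨h2, -⟩
    · rw [h2]; exact hAv
    · rw [h2]; exact hAv'
  · rcases hev with ⟨-, h3⟩ | ⟨-, h3⟩
    · rw [h3]; exact hAv'
    · rw [h3]; exact hAv
  · rcases hev with ⟨h2, -⟩ | ⟨h2, -⟩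
    · rw [h2]; exact hw₂v.1
    · rw [h2]; exact hw₂v.2.1
  · rcases hev with ⟨-, h3⟩ | ⟨-, h3⟩
    · rw [h3]; exact hw₂v.2.1
    · rw [h3]; exact hw₂v.1
  · -- (i) implication + coupling on `J₀ ∖ e`
    intro x hxJ hxw
    set s := sform I y e x with hs
    set x₁ : Fin n → Bool := Function.update (Function.update x v s) v' s with hx₁
    have hx₁J : ∀ j ∈ J₀, I.eval x₁ j = y j := by
      intro j hj
      by_cases hje' : j = e
      · subst hje'
        rw [eval_iff_sform I hI, prod_e, hx₁, sform_upd]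
        rw [Function.update_of_ne hvv', Function.update_self, Function.update_self, Bool.and_self]
      · have hx0 : ∀ j ∈ J₀, j ≠ e → I.eval x j = y j := fun j hj hje' => hxJ j (mem_erase.2 ⟨hje', hj⟩)
        rw [hx₁]
        rcases hev with ⟨h2, h3⟩ | ⟨h2, h3⟩
        · rw [← h2, ← h3, eval_setPair_of_ne I heJ (hch e he) x s s hj hje']; exact hx0 j hj hje'
        · rw [← h2, ← h3, Function.update_comm (fun h => absurd (hI.2 e h) (by decide)), eval_setPair_of_ne I heJ (hch e he) x s s hj hje']
          exact hx0 j hj hje'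
    have hA₁ := (invA x s s).1
    have hW₁ := (invA x s s).2
    rw [← hx₁] at hA₁ hW₁
    have hx₁w : gval I w₂.1 w₂.2.1 x₁ = w₂.2.2 := by rw [hW₁]; exact hxw
    have hx₁v : x₁ v = s := by rw [hx₁, Function.update_of_ne hvv', Function.update_self]
    have hx₁u : x₁ u = x u := by rw [hx₁, Function.update_of_ne huv', Function.update_of_ne huv]
    have hne1 : gval I w₁.1 w₁.2.1 x₁ ≠ w₁.2.2 := hT3' x₁ hx₁J hx₁w
    have hb := bit_gval_gate I w₁ hg₀ hgv x₁
    rw [hx₁v, hx₁u, hA₁, hlam] at hb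
    -- on the `s = 0` part, `x_u = pol`
    have hpolu : s = false → x u = pol := by
      intro hs0
      have h := (shape x₁ hx₁J hx₁w (by rw [hx₁v, hs0])).2
      rw [hx₁u] at h
      rw [hpol]
      by_cases hvC : v ∈ w₁.1
      · rw [h.1 hvC]; simp [hvC]
      · have : x u ≠ true := fun hu' => hvC (h.2 hu')
        simp [hvC]; revert this; cases x u <;> simp
    constructor
    · apply bit_injective
      rw [bit_xor]
      have e4 : ∀ (W A xu sb pb t : ZMod 2), (sb = 0 ∨ sb = 1) → (sb = 0 → xu = pb) → W ≠ t → (W = t ∨ W = t + 1) →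
          W = A + xu + sb * (pb + xu) → A = (t + 1) + pb := by decide
      have h01 : ∀ b : Bool, bit b = 0 ∨ bit b = 1 := by decide
      have hWt : bit (gval I w₁.1 w₁.2.1 x₁) = bit w₁.2.2 ∨ bit (gval I w₁.1 w₁.2.1 x₁) = bit w₁.2.2 + 1 := by
        cases gval I w₁.1 w₁.2.1 x₁ <;> cases w₁.2.2 <;> decide
      have hnotb : ∀ b : Bool, bit (!b) = bit b + 1 := by decide
      rw [hnotb]
      refine e4 _ _ _ _ _ _ (h01 s) (fun h0 => ?_) (fun h => hne1 (bit_injective h)) hWt hb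
      have hs0 : s = false := by revert h0; cases s <;> simp [bit]
      rw [hpolu hs0]
    · intro hxor
      by_contra hs1
      have hs0 : s = false := by revert hs1; cases s <;> simp
      rw [hpolu hs0] at hxor
      revert hxor; cases pol <;> simp
  · -- (ii) minimality
    intro f hf
    have hfJ : f ∈ J₀ := (mem_erase.1 hf).2
    have hfe : f ≠ e := (mem_erase.1 hf).1
    obtain ⟨x, hxJ, hx1, hx2⟩ := hM0 f hfJ
    refine ⟨x, fun j hj => hxJ j (mem_erase.2 ⟨(mem_erase.1 hj).1, (mem_erase.1 (mem_erase.1 hj).2).2⟩), hx2, ?_⟩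
    rintro ⟨hA, himp⟩
    have hb := bit_gval_gate I w₁ hg₀ hgv x
    rw [hx1, hA, bit_xor, hlam] at hb
    have heq : sform I y e x = (x v && x v') := by
      have h := (eval_iff_sform I hI y e x).1 (hxJ e (mem_erase.2 ⟨hfe.symm, heJ⟩))
      rw [prod_e] at h; exact h.symm
    have e5 : ∀ (t pb xu xv : ZMod 2), t = (bit true + t + pb) + xu + xv * (pb + xu) → (xv = 0 ∨ xv = 1) → xv = 0 ∧ pb + xu = 1 := by decide
    have hnotb : bit (!w₁.2.2) = bit true + bit w₁.2.2 := by cases w₁.2.2 <;> decide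
    rw [hnotb] at hb
    obtain ⟨hxv, hl⟩ := e5 _ _ _ _ hb (by cases x v <;> simp [bit])
    have hxv' : x v = false := by revert hxv; cases x v <;> simp [bit]
    have hxor : xor (x u) pol = true := by
      revert hl; cases x u <;> cases pol <;> simp [bit]
    have h := himp hxor
    rw [heq, hxv', Bool.false_and] at h
    exact Bool.false_ne_true h
  · -- (iii) the literal is on somewhere: `u` free
    obtain ⟨z, hzJ, hz0, hzw⟩ := hfu (!pol)
    have hzu : z u = !pol := by
      have h : gval I {u} ∅ z = !pol := hz0
      rwa [gval_singleton] at h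
    exact ⟨z, fun j hj => hzJ j (mem_erase.1 hj).2, hzw, by rw [hzu]; cases pol <;> rfl⟩
  · -- (iii) the path-sum is off somewhere: `v` free
    exact ⟨z₀, fun j hj => hz₀J j (mem_erase.1 hj).2, hz₀w, chord_s hz₀J hz₀v⟩

/-- **The blind free cotree-partner gate reduces to the implication-coupled datum: `CoupledFour → TerminalFiveCotree1Blind`.** -/
theorem cotree1Blind_of_coupledFour (hC : CoupledFour) : TerminalFiveCotree1Blind := by
  intro n m r I hI hT hS hB y J₀ w₁ w₂ ht F hF hP hmax hch g₀ hg₀ sp hcg hun h2 h3 hbl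
  obtain ⟨hsp, hpriv, hu⟩ := hcg
  rcases hsp with rfl | rfl
  · rw [if_pos rfl] at hu
    exact cotree1Blind_core hC I hI hT hS hB ht hF hP hmax hch hg₀ (Or.inl ⟨rfl, rfl⟩) hpriv hu hun h2 h3 hbl
  · rw [if_neg (by decide)] at hu
    exact cotree1Blind_core hC I hI hT hS hB ht hF hP hmax hch hg₀ (Or.inr ⟨rfl, rfl⟩) hpriv hu hun h3 h2 hbl

end Summit.PneNP.PneNP.Theorems.PstarCotreeCoupled
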